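import Summits.AtomisticToContinuum.BoseEinsteinCondensation.Theorems.BECGroundStateSOSPeriodicIRBoundReductionBounded
import Summits.AtomisticToContinuum.BoseEinsteinCondensation.Theorems.BECSectorPoincareTwoScaleLandauToPeriodicBECModeCounting
import Summits.AtomisticToContinuum.BoseEinsteinCondensation.Theorems.BECSectorPoincareTwoScaleLandauToPeriodicBECLinearFloor
import HarnessLib

/-!
# Route `BECSectorPoincareTwoScale`, support item `LandauToPeriodicBEC` (stmt-AtomisticToContinuum-9095) —
# the bridge per potential, its unconditional cases, and its reduction to the open inputs

`LandauToPeriodicBEC` says: for each repulsive finite-range `v`, the body of `EnergyConvexityWindow` for `v` and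
the body of `LandauSectorBound` for `v` imply the body of `PeriodicBEC` for `v` (condensation
`⟨Ψ, n₀Ψ⟩ ≥ cN` of the `δ_N`-near-minimisers on the torus of side `(N/ρ)^{1/3}` at all small densities).
This file assembles it from landed theorems of the sibling crux line `PeriodicIRBound/linear-ph-floor-wagner`
(route `BECGroundStateSOS`) and the two per-potential helpers of this item:

* `linearFloorFor_of_landau` (helper II): the two bodies give the linear particle–hole floor `C⁺(v)` when
  `∫v ≠ 0`;
* `irBoundFor_of_linearFloor_of_gap` / `…_of_bounded` / `…_of_hardCoreWF` (landed, Wagner–Feynman two-sided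
  moment bound + window arithmetic): `C⁺(v)` and the fixed-`(N,L)` zero-momentum gap (a THEOREM for bounded
  `v`, `zeroMomentumGapFor_of_bounded`, and for a.e.-zero `v`) — or, for non-integrable `v`, the dressed moment
  bound of stub 6b's shape — give the infrared bound `IRBoundFor v`;
* `periodicBEC_of_irBoundFor` (helper I, mode counting per potential): `IRBoundFor v` gives the `PeriodicBEC`
  body for `v`.

Results: the bridge for ONE potential from the two residual inputs (`landauToPeriodicBEC_for`); UNCONDITIONALLY
for every BOUNDED admissible `v` (`landauToPeriodicBEC_bounded`) and for every a.e.-zero `v`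
(`periodicBEC_of_lintegral_eq_zero`, where even the two bodies are not needed; `FreeGasCondensation`, stmt-11847, by name in the companion file `…BECNoCheapMomentumFreeGasCondensation.lean`); and `LandauToPeriodicBEC` BY NAME
from (a) the zero-momentum gap for UNBOUNDED integrable admissible `v` (the unbounded half of
`BECNoCheapMomentum.ZeroMomentumGround`, stmt-11845) together with (b) EITHER the hard-core moment bound
`HardCoreWagnerFeynmanBound` (stub 6b of crux stmt-3972) OR `BECNoCheapMomentum.HardCoreMomentBound`
(stmt-11844) — `landauToPeriodicBEC_of_open_inputs`, `landauToPeriodicBEC_of_hardCoreMomentBound`,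
`landauToPeriodicBEC_of_zeroMomentumGround`. The planner's junction composition (Sketch.lean) is recorded as
`landauToPeriodicBEC_of_junction`. No new definitions; pure composition.

References: H. Wagner, Z. Physik 195 (1966) 273; S. Stringari, in *Bose–Einstein Condensation* (CUP 1995) §2.2;
L. Pitaevskii, S. Stringari, J. Low Temp. Phys. 85 (1991) 377; LSSY2005 Thm. 2.2, §1.2.
-/

noncomputable section

open scoped BigOperators ENNReal
open Filter MeasureTheory

namespace Summit.AtomisticToContinuum.BoseEinsteinCondensation.Theorems.LandauToPeriodicBEC

open Literature.MathematicalPhysics.QuantumManyBody.BoseGas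
open Summit.AtomisticToContinuum.BoseEinsteinCondensation.Theses.BECSectorPoincareTwoScale
  (LandauSectorBound EnergyConvexityWindow LandauToPeriodicBEC LandauFloorToSectorGap)
open Summit.AtomisticToContinuum.BoseEinsteinCondensation.Theses.BECNoCheapMomentum
  (ZeroMomentumGround HardCoreMomentBound MomentBoundCondensation FreeGasCondensation)
open Summit.AtomisticToContinuum.BoseEinsteinCondensation.Cruxes.PeriodicIRBound.LinearPhFloorWagner
  (LinearFloorFor ZeroMomentumGapFor HardCoreWagnerFeynmanWith HardCoreWagnerFeynmanBound
    irBoundFor_of_linearFloor_of_gap irBoundFor_of_linearFloor_of_bounded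
    irBoundFor_of_linearFloor_of_hardCoreWF lintegral_norm_ne_top_of_bounded zeroMomentumGapFor_of_bounded)
open Summit.AtomisticToContinuum.BoseEinsteinCondensation.Theorems.PeriodicIRBound.Negative
  (IRBoundFor zeroMomentumGapFor_of_lintegral_eq_zero)

/-! ## §1 The bridge for one potential -/

/-- **`LandauToPeriodicBEC` for ONE potential, from the two residual inputs.** For a repulsive finite-range
`v`, assume (a) if `v` is integrable, not a.e. zero and UNBOUNDED, the fixed-`(N,L)` zero-momentum gap
`E₀^per(N,L) < E^per_N(q;L)` (`q ≠ 0`), and (b) if `v` is NON-integrable (`∫v = ⊤`), the dressed per-mode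
moment bound of stub 6b's shape for every window constant. Then the convexity body and the Landau body for `v`
imply the `PeriodicBEC` body for `v` (with `c = 1/2`). Cases: `∫v = 0` is the free gas (zero-momentum gap and
infrared bound outright); bounded `v` has the gap by Perron–Frobenius (`zeroMomentumGapFor_of_bounded`); the
rest is (a)/(b); in all cases `C⁺(v)` comes from the two bodies (`linearFloorFor_of_landau`), the infrared
bound from the landed Wagner–Feynman chain, and condensation from mode counting (`periodicBEC_of_irBoundFor`).
[folklore] -/
theorem landauToPeriodicBEC_for (v : ℝ → ℝ≥0∞) (hv : IsRepulsiveFiniteRange v)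
    (hzmg : (∫⁻ x : Space, v ‖x‖) ≠ ⊤ → (∫⁻ x : Space, v ‖x‖) ≠ 0 →
      (¬ ∃ M : ℝ≥0∞, M ≠ ⊤ ∧ ∀ r, v r ≤ M) → ZeroMomentumGapFor v)
    (hhc : (∫⁻ x : Space, v ‖x‖) = ⊤ →
      ∀ C : ℝ, 0 < C → ∃ A : ℝ, 0 < A ∧ ∃ ρ₁ : ℝ, 0 < ρ₁ ∧ HardCoreWagnerFeynmanWith v C A ρ₁)
    (hconv : ∃ ρ₁ : ℝ, 0 < ρ₁ ∧ ∀ ε : ℝ, 0 < ε → ∀ ρ : ℝ, 0 < ρ → ρ < ρ₁ → ∀ᶠ N : ℕ in Filter.atTop,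
      ∀ L : ℝ, 0 < L → ρ / 2 ≤ (N : ℝ) / L ^ 3 → (N : ℝ) / L ^ 3 ≤ 2 * ρ →
        2 * periodicGroundStateEnergy v N L ≤ periodicGroundStateEnergy v (N + 1) L +
          periodicGroundStateEnergy v (N - 1) L +
            ENNReal.ofReal (ε * Real.sqrt (ρ * (scatteringLength v).toReal) / L))
    (hlandau : ∀ M₀ : ℝ, 0 < M₀ → ∃ θ : ℝ, 0 < θ ∧ ∃ ρ₀ : ℝ, 0 < ρ₀ ∧ ∀ ρ : ℝ, 0 < ρ → ρ < ρ₀ →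
      ∀ᶠ N : ℕ in Filter.atTop, ∀ L : ℝ, 0 < L → ρ / 2 ≤ (N : ℝ) / L ^ 3 → (N : ℝ) / L ^ 3 ≤ 2 * ρ →
        ∀ m : Fin 3 → ℤ, m ≠ 0 →
          let a : ℝ := (scatteringLength v).toReal
          let k : ℝ := 2 * Real.pi / L * ‖(WithLp.toLp 2 fun t => (m t : ℝ) : EuclideanSpace ℝ (Fin 3))‖
          k ≤ M₀ * Real.sqrt (ρ * a) → ∀ Ψ : PeriodicTrialState N L,
            (∀ (X : Config N) (s : EuclideanSpace ℝ (Fin 3)), Ψ.ψ (fun j => X j + s) =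
              Complex.exp (Complex.I * ↑(2 * Real.pi / L * ∑ t : Fin 3, (m t : ℝ) * s t)) * Ψ.ψ X) →
            periodicGroundStateEnergy v N L + ENNReal.ofReal (θ * Real.sqrt (ρ * a) * k) ≤
              periodicEnergy v Ψ) :
    ∃ ρ₀ : ℝ, 0 < ρ₀ ∧ ∀ ρ : ℝ, 0 < ρ → ρ < ρ₀ → ∃ c : ℝ, 0 < c ∧ ∀ᶠ N : ℕ in Filter.atTop,
      ∃ δ : ℝ≥0∞, 0 < δ ∧ ∀ Ψ : PeriodicTrialState N (sideLength ρ N),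
        periodicEnergy v Ψ ≤ periodicGroundStateEnergy v N (sideLength ρ N) + δ →
          ENNReal.ofReal (c * N) ≤ condensateOccupation N (sideLength ρ N) Ψ.ψ := by
  refine periodicBEC_of_irBoundFor v hv ?_
  have hfloor : (∫⁻ x : Space, v ‖x‖) ≠ 0 → LinearFloorFor v :=
    linearFloorFor_of_landau v hv hconv hlandau
  by_cases htop : (∫⁻ x : Space, v ‖x‖) = ⊤
  · -- non-integrable: the dressed moment bound (b) and the window arithmetic of stub 6
    exact irBoundFor_of_linearFloor_of_hardCoreWF v hv htop (hhc htop)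
      (hfloor (ne_of_eq_of_ne htop ENNReal.top_ne_zero))
  by_cases h0 : (∫⁻ x : Space, v ‖x‖) = 0
  · -- a.e.-free gas: the zero-momentum gap is the free one
    exact irBoundFor_of_linearFloor_of_gap v hv htop hfloor
      (zeroMomentumGapFor_of_lintegral_eq_zero hv.1 h0)
  by_cases hbdd : ∃ M : ℝ≥0∞, M ≠ ⊤ ∧ ∀ r, v r ≤ M
  · -- bounded: Perron–Frobenius on the torus (Reed–Simon XIII.12)
    exact irBoundFor_of_linearFloor_of_bounded v hv hbdd hfloor
  · -- unbounded integrable, not a.e. zero: the residual gap hypothesis (a)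
    exact irBoundFor_of_linearFloor_of_gap v hv htop hfloor (hzmg htop h0 hbdd)

/-- **`LandauToPeriodicBEC` for every BOUNDED admissible potential, unconditionally**: for a repulsive
finite-range `v ≤ M < ⊤` the convexity body and the Landau body for `v` imply the `PeriodicBEC` body for `v`.
[folklore] -/
theorem landauToPeriodicBEC_bounded (v : ℝ → ℝ≥0∞) (hv : IsRepulsiveFiniteRange v)
    (hM : ∃ M : ℝ≥0∞, M ≠ ⊤ ∧ ∀ r, v r ≤ M)
    (hconv : ∃ ρ₁ : ℝ, 0 < ρ₁ ∧ ∀ ε : ℝ, 0 < ε → ∀ ρ : ℝ, 0 < ρ → ρ < ρ₁ → ∀ᶠ N : ℕ in Filter.atTop,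
      ∀ L : ℝ, 0 < L → ρ / 2 ≤ (N : ℝ) / L ^ 3 → (N : ℝ) / L ^ 3 ≤ 2 * ρ →
        2 * periodicGroundStateEnergy v N L ≤ periodicGroundStateEnergy v (N + 1) L +
          periodicGroundStateEnergy v (N - 1) L +
            ENNReal.ofReal (ε * Real.sqrt (ρ * (scatteringLength v).toReal) / L))
    (hlandau : ∀ M₀ : ℝ, 0 < M₀ → ∃ θ : ℝ, 0 < θ ∧ ∃ ρ₀ : ℝ, 0 < ρ₀ ∧ ∀ ρ : ℝ, 0 < ρ → ρ < ρ₀ →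
      ∀ᶠ N : ℕ in Filter.atTop, ∀ L : ℝ, 0 < L → ρ / 2 ≤ (N : ℝ) / L ^ 3 → (N : ℝ) / L ^ 3 ≤ 2 * ρ →
        ∀ m : Fin 3 → ℤ, m ≠ 0 →
          let a : ℝ := (scatteringLength v).toReal
          let k : ℝ := 2 * Real.pi / L * ‖(WithLp.toLp 2 fun t => (m t : ℝ) : EuclideanSpace ℝ (Fin 3))‖
          k ≤ M₀ * Real.sqrt (ρ * a) → ∀ Ψ : PeriodicTrialState N L,
            (∀ (X : Config N) (s : EuclideanSpace ℝ (Fin 3)), Ψ.ψ (fun j => X j + s) =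
              Complex.exp (Complex.I * ↑(2 * Real.pi / L * ∑ t : Fin 3, (m t : ℝ) * s t)) * Ψ.ψ X) →
            periodicGroundStateEnergy v N L + ENNReal.ofReal (θ * Real.sqrt (ρ * a) * k) ≤
              periodicEnergy v Ψ) :
    ∃ ρ₀ : ℝ, 0 < ρ₀ ∧ ∀ ρ : ℝ, 0 < ρ → ρ < ρ₀ → ∃ c : ℝ, 0 < c ∧ ∀ᶠ N : ℕ in Filter.atTop,
      ∃ δ : ℝ≥0∞, 0 < δ ∧ ∀ Ψ : PeriodicTrialState N (sideLength ρ N),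
        periodicEnergy v Ψ ≤ periodicGroundStateEnergy v N (sideLength ρ N) + δ →
          ENNReal.ofReal (c * N) ≤ condensateOccupation N (sideLength ρ N) Ψ.ψ :=
  landauToPeriodicBEC_for v hv (fun _ _ h => absurd hM h)
    (fun htop => absurd (lintegral_norm_ne_top_of_bounded hv hM) (not_not_intro htop)) hconv hlandau

/-- **The a.e.-free gas condenses on the torus** (no sector input at all): for a repulsive finite-range `v`
with `∫ v(|x|)dx = 0` the `PeriodicBEC` body holds — the zero-momentum gap and the infrared bound are the free
ones, then mode counting. This is also the body of `BECNoCheapMomentum.FreeGasCondensation` (stmt-11847) for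
`v`. [folklore] -/
theorem periodicBEC_of_lintegral_eq_zero (v : ℝ → ℝ≥0∞) (hv : IsRepulsiveFiniteRange v)
    (h0 : (∫⁻ x : Space, v ‖x‖) = 0) :
    ∃ ρ₀ : ℝ, 0 < ρ₀ ∧ ∀ ρ : ℝ, 0 < ρ → ρ < ρ₀ → ∃ c : ℝ, 0 < c ∧ ∀ᶠ N : ℕ in Filter.atTop,
      ∃ δ : ℝ≥0∞, 0 < δ ∧ ∀ Ψ : PeriodicTrialState N (sideLength ρ N),
        periodicEnergy v Ψ ≤ periodicGroundStateEnergy v N (sideLength ρ N) + δ →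
          ENNReal.ofReal (c * N) ≤ condensateOccupation N (sideLength ρ N) Ψ.ψ :=
  periodicBEC_of_irBoundFor v hv
    (irBoundFor_of_linearFloor_of_gap v hv (ne_of_eq_of_ne h0 ENNReal.zero_ne_top)
      (fun h => absurd h0 h) (zeroMomentumGapFor_of_lintegral_eq_zero hv.1 h0))

/-! ## §2 `LandauToPeriodicBEC` by name from its open inputs -/

/-- **The item from its two open inputs**: (a) the fixed-`(N,L)` zero-momentum gap for UNBOUNDED integrable
admissible potentials that are not a.e. zero (the unbounded half of stmt-11845 `ZeroMomentumGround`), and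
(b) the hard-core moment bound `HardCoreWagnerFeynmanBound` (stub 6b of crux stmt-3972 `PeriodicIRBound`),
imply `LandauToPeriodicBEC` by name. [folklore] -/
theorem landauToPeriodicBEC_of_open_inputs
    (h₃ : ∀ v : ℝ → ℝ≥0∞, IsRepulsiveFiniteRange v → (∫⁻ x : Space, v ‖x‖) ≠ ⊤ →
      (∫⁻ x : Space, v ‖x‖) ≠ 0 → (¬ ∃ M : ℝ≥0∞, M ≠ ⊤ ∧ ∀ r, v r ≤ M) → ZeroMomentumGapFor v)
    (h₈ : HardCoreWagnerFeynmanBound) : LandauToPeriodicBEC :=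
  fun v hv hconv hlandau => landauToPeriodicBEC_for v hv (h₃ v hv) (h₈ v hv) hconv hlandau

/-- **The item from stmt-11845 and stub 6b**: `ZeroMomentumGround → HardCoreWagnerFeynmanBound →
LandauToPeriodicBEC`. [folklore] -/
theorem landauToPeriodicBEC_of_zeroMomentumGround (h₃ : ZeroMomentumGround)
    (h₈ : HardCoreWagnerFeynmanBound) : LandauToPeriodicBEC :=
  landauToPeriodicBEC_of_open_inputs (fun v hv hint _ _ N L hL q hq => h₃ v hv hint N L hL q hq) h₈

/-- Per potential, the linear particle–hole floor `C⁺(v)` implies the tail of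
`BECNoCheapMomentum.SectorGapFloor` for `v` (quadratic floor `2κ‖k‖²`, `κ := θ/√C`, since `‖k‖ ≤ √(Cρ)` on
the window) — the per-`v` form of the landed pooling lemma `sectorGapFloor_of_linearParticleHoleFloor`.
[folklore] -/
theorem sectorGapTail_of_linearFloorFor (v : ℝ → ℝ≥0∞) (h : LinearFloorFor v) :
    ∀ C : ℝ, 0 < C → ∃ κ : ℝ, 0 < κ ∧ ∃ ρ₀ : ℝ, 0 < ρ₀ ∧ ∀ ρ : ℝ, 0 < ρ → ρ < ρ₀ →
      ∀ᶠ N : ℕ in Filter.atTop, ∀ k : EuclideanSpace ℝ (Fin 3), k ≠ 0 → ‖k‖ ^ 2 ≤ C * ρ →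
        2 * periodicGroundStateEnergy v N (sideLength ρ N) + ENNReal.ofReal (2 * κ * ‖k‖ ^ 2) ≤
          (⨅ (Ψ : PeriodicTrialState (N + 1) (sideLength ρ N)) (_ : ∀ (s : EuclideanSpace ℝ (Fin 3))
            (X : Fin (N + 1) → EuclideanSpace ℝ (Fin 3)), Ψ.ψ (fun i => X i + s) =
              Complex.exp (Complex.I * ↑(∑ j, k j * s j)) * Ψ.ψ X), periodicEnergy v Ψ) +
          (⨅ (Ψ : PeriodicTrialState (N - 1) (sideLength ρ N)) (_ : ∀ (s : EuclideanSpace ℝ (Fin 3))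
            (X : Fin (N - 1) → EuclideanSpace ℝ (Fin 3)), Ψ.ψ (fun i => X i + s) =
              Complex.exp (Complex.I * ↑(∑ j, k j * s j)) * Ψ.ψ X), periodicEnergy v Ψ) := by
  intro C hC
  obtain ⟨θ, hθ, ρ₀, hρ₀, hθρ⟩ := h C hC
  have hCpos : 0 < Real.sqrt C := Real.sqrt_pos.2 hC
  refine ⟨θ / Real.sqrt C, div_pos hθ hCpos, ρ₀, hρ₀, fun ρ hρ hρρ₀ => ?_⟩
  filter_upwards [hθρ ρ hρ hρρ₀] with N hN k hk hkC
  refine le_trans ?_ (hN k hk hkC)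
  have hkn : 0 ≤ ‖k‖ := norm_nonneg k
  have hk' : ‖k‖ ≤ Real.sqrt C * Real.sqrt ρ := by
    rw [← Real.sqrt_mul hC.le, ← Real.sqrt_sq hkn]
    exact Real.sqrt_le_sqrt hkC
  have key : 2 * (θ / Real.sqrt C) * ‖k‖ ^ 2 ≤ 2 * θ * Real.sqrt ρ * ‖k‖ :=
    calc 2 * (θ / Real.sqrt C) * ‖k‖ ^ 2
        = 2 * (θ / Real.sqrt C) * ‖k‖ * ‖k‖ := by ring
      _ ≤ 2 * (θ / Real.sqrt C) * (Real.sqrt C * Real.sqrt ρ) * ‖k‖ := by gcongr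
      _ = 2 * θ * Real.sqrt ρ * ‖k‖ := by field_simp
  exact add_le_add le_rfl (ENNReal.ofReal_le_ofReal key)

/-- **The item from stmt-11845 (unbounded half) and stmt-11844** (`BECNoCheapMomentum.HardCoreMomentBound`,
the Jastrow-dressed chain for non-integrable potentials, consuming the `SectorGapFloor` tail that `C⁺(v)`
provides): the junction form of the reduction with the hard-core input taken from route `BECNoCheapMomentum`.
[folklore] -/
theorem landauToPeriodicBEC_of_hardCoreMomentBound
    (h₃ : ∀ v : ℝ → ℝ≥0∞, IsRepulsiveFiniteRange v → (∫⁻ x : Space, v ‖x‖) ≠ ⊤ →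
      (∫⁻ x : Space, v ‖x‖) ≠ 0 → (¬ ∃ M : ℝ≥0∞, M ≠ ⊤ ∧ ∀ r, v r ≤ M) → ZeroMomentumGapFor v)
    (h₄ : HardCoreMomentBound) : LandauToPeriodicBEC := by
  intro v hv hconv hlandau
  by_cases htop : (∫⁻ x : Space, v ‖x‖) = ⊤
  · exact h₄ v hv htop (sectorGapTail_of_linearFloorFor v
      (linearFloorFor_of_landau v hv hconv hlandau (ne_of_eq_of_ne htop ENNReal.top_ne_zero)))
  · exact landauToPeriodicBEC_for v hv (h₃ v hv) (fun h => absurd h htop) hconv hlandau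

/-- **The planner's junction composition** (route file § Assembly; `landauToPeriodicBEC_of_junction` of the
repair planner's Sketch.lean): the glue `LandauFloorToSectorGap` (stmt-9096) and the `BECNoCheapMomentum` items
`HardCoreMomentBound` (stmt-11844), `ZeroMomentumGround` (stmt-11845), `MomentBoundCondensation` (stmt-11846),
`FreeGasCondensation` (stmt-11847) give the item by trichotomy on `∫v`. Pure logic. [folklore] -/
theorem landauToPeriodicBEC_of_junction (h96 : LandauFloorToSectorGap) (h44 : HardCoreMomentBound)
    (h45 : ZeroMomentumGround) (h46 : MomentBoundCondensation) (h47 : FreeGasCondensation) :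
    LandauToPeriodicBEC := by
  intro v hv hconv hlandau
  by_cases h0 : (∫⁻ x : Space, v ‖x‖) = 0
  · exact h47 v hv h0
  · by_cases htop : (∫⁻ x : Space, v ‖x‖) = ⊤
    · exact h44 v hv htop (h96 v hv hconv hlandau h0)
    · exact h46 v hv htop h0 (h45 v hv htop) (h96 v hv hconv hlandau h0)

end Summit.AtomisticToContinuum.BoseEinsteinCondensation.Theorems.LandauToPeriodicBEC

/-! ## §3 The route item -/

namespace Summit.AtomisticToContinuum.BoseEinsteinCondensation.Theorems

open Summit.AtomisticToContinuum.BoseEinsteinCondensation.Theses.BECSectorPoincareTwoScale (LandauToPeriodicBEC)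
open Summit.AtomisticToContinuum.BoseEinsteinCondensation.Theses.BECNoCheapMomentum
  (ZeroMomentumGround HardCoreMomentBound)

/-- **Route `BECSectorPoincareTwoScale`, item `LandauToPeriodicBEC` (stmt-AtomisticToContinuum-9095)** — the
bridge `EnergyConvexityWindow-body(v) → LandauSectorBound-body(v) → PeriodicBEC-body(v)` for every repulsive
finite-range `v`, as the junction corollary it is filed as: PROVED for bounded potentials and for a.e.-zero
potentials outright (`LandauToPeriodicBEC.landauToPeriodicBEC_bounded`, `…periodicBEC_of_lintegral_eq_zero`),
and for the remaining classes from the two registered items of route `BECNoCheapMomentum` that carry the open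
mathematics — `ZeroMomentumGround` (stmt-11845; used only for UNBOUNDED integrable `v`, its bounded half being the
theorem `zeroMomentumGapFor_of_bounded`) and `HardCoreMomentBound` (stmt-11844; the Jastrow-dressed chain for
`∫v = ⊤`). Chain: the two bodies give the linear particle–hole floor `C⁺(v)` (`linearFloorFor_of_landau`); for
integrable `v` the landed two-sided Wagner–Feynman moment bound and window arithmetic of crux `PeriodicIRBound`
(`irBoundFor_of_linearFloor_of_gap`) give the infrared bound `n_k ≤ C√ρL_N/‖k‖_∞`, and mode counting
(`periodicBEC_of_irBoundFor`) gives `n₀ ≥ N/2`; for `∫v = ⊤`, `C⁺(v)` gives the `SectorGapFloor` tail consumed by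
stmt-11844. [cite: Wagner1966] [cite: Stringari1995, §2.2 (16)] [cite: LSSY2005, Thm. 2.2 and §1.2 (1.17)–(1.19)] -/
theorem LandauToPeriodicBEC_proof (h₁ : ZeroMomentumGround) (h₂ : HardCoreMomentBound) : LandauToPeriodicBEC :=
  LandauToPeriodicBEC.landauToPeriodicBEC_of_hardCoreMomentBound
    (fun v hv hint _ _ N L hL q hq => h₁ v hv hint N L hL q hq) h₂

end Summit.AtomisticToContinuum.BoseEinsteinCondensation.Theorems

end
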